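/-
Copyright (c) 2026 the pub-hodgecm-mathlib formalisation cell (harness21).  Prover seat hodgecm-mathlib-K2E3-p23 (g8), Track B «K2-LIT» ∕ hLiu418 #184♮,
Road I v3, unit U5 «THE CLOSE», FACE-D₀ row `h2₂`: THE SMALL LETTERS of ★ p863240 `K2LiuFirstTermLineLiftRankRowModel` ED. 2's head
(LEAD F0P6-plan (g14) BATCH #167 (1), 2026-09-04T23:48:34Z; census R90-C10-p06 (g2) `CENSUS-D0-SmallLetters` 354eda7923e67881).  THEOREMS ONLY.
-/
import Summits.HodgeConjecture.HodgeConjecture.Theorems.K2LiuSiegelUnipotentLocalDefs     -- ★ Φ3b: `unipDeltaLoc`, `mem_unipDeltaLoc_iff`, `locToAdelic_mem_unipDelta`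
import Summits.HodgeConjecture.HodgeConjecture.Theorems.K2LiuSiegelUnipotentCharacters    -- ★ Φ1: `unipDeltaChar_mul ∕ _one`, `trace_mul_single`
import Literature.NumberTheory.K2Lit.DoubledLineThetaKernel                                -- ★ D8: `dD`, `hermD_eq_diagonal_dD`, `toDiagA`, `coe_toDiagA`
import HarnessLib

/-!
# K2_Liu road (hLiu418 = stmt-HodgeConjecture-24832), U5 «THE CLOSE», FACE-D₀ row `h2₂`: THE SMALL LETTERS `hπ`, `hκι`, `χ ∕ hχS` OF THE FINITE LINE MODEL

Cell `pub/hodgecm-mathlib` (D-0151), Track B, build stream 29; helper lane `--supports stmt-HodgeConjecture-24832 --as helper`, count-neutral; closes no socket.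
Desk K2Liu-p02 (g8) ∕ K2Liu-p10 (g6); (B1c′) core R90-C14-p04 (g0); box K2E5-r02 (g6).  THEOREMS ONLY (no `def`, no `instance`, no notation, no named-fact
hypothesis, no `sorry`).

★ p863240 `K2LiuFirstTermLineLiftRankRowModel.h2Row_thetaSide_of_finLineModel_intertwined` pays FACE-D′'s row `h2₂` MODULO the letters of ★ U2a's σ-explicit
line model (`σ hσ hσF π hπ ψ hψ ρf b hb a ha v hu hρm βloc hherm hdet χ hχ`), the Weil letters (`ι hχS`; `ρW hIW Tκ hT`) and ★ p863159's bookkeeping `κ ι hκι`.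
THIS FILE (§1) pays the letters whose nouns are NOT fixed by the (B1c′) chirp model — typed so that ANY instance the (B1c′) core chooses can use them:
* §1.1 **`exists_herm_pairing_ne_zero`** — U2a's `hπ` for EVERY pairing `π s H = τ (tr (s H))` built from an `F`-linear functional `τ : R →ₗ[F] F` that is
  `σ`-invariant with non-degenerate `τ`-form, `(2 : F) ≠ 0` (instance: `τ := Algebra.trace L⁺_v L_w`): a non-zero hermitian `H` pairs non-trivially with the
  hermitian test matrix `[[0, σ d], [d, 0]]` (off-diagonal entry) or `(y + σ y) • E_ii` (diagonal entry).
* §1.2 **`toDiagA_locToAdelic_eq_finAdelicToAdelic`** — ★ p863159's `hκι` at THE group `Z := ↥(unipDeltaLoc … v)` (= `N_Δ(L⁺_v)` at one finite place `v` of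
  `L⁺`), `ι z := locToAdelic v z`, `κ := inclPlace v ∘ (localPi hermD v = localPi (diagonal dD) v)` — identity of matrices (★ `hermD_eq_diagonal_dD`); and its
  `∃ κ` form **`exists_kappa_toDiagA_locToAdelic`**.
* §1.3 **`exists_hom_coe_eq_unipDeltaChar_locToAdelic`** — the multiplier character `χ : Z →* ℂˣ` with `χ z = ψ_S(ι z)` BY CONSTRUCTION (★ `unipDeltaChar_mul ∕ _one`,
  `Circle.toUnits`), so that ED. 2's `hχS` holds definitionally and the instance-bound content is concentrated in `hχ` (= ★ Φ3d (d1)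
  `unipDeltaChar_locToAdelic_eq_prod` + the tower identity `ψ_{L,w} = ψ_{L⁺,v} ∘ Tr` + the skew ↔ hermitian dictionary — §2, after the (B1c′) nouns).
`hψ` is ★ `AdeleAddCharLocalNontrivial.exists_adeleAddCharAt_ne_one` by name once `ψ := ψ_{L⁺,v}`.

References: [Rallis1984] S. Rallis, Compositio Math. 51 (1984) §4; [KudlaRallis1994] S. Kudla, S. Rallis, Ann. of Math. 140 (1994) §3; [Shimura1997] G. Shimura,
CBMS 93 (1997) §18.1; [MoeglinWaldspurger1995] C. Mœglin, J.-L. Waldspurger (1995) I.2.1, I.2.6; [GelbartRogawski1991] Invent. Math. 105 (1991) §3.1 Prop. 3.1.1.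
HONEST LABEL: HC_CM is proved only modulo the 7 printed citations (2 remaining named inputs: hLiu418 = stmt-HodgeConjecture-24832, h413 = stmt-HodgeConjecture-24833)
until rung 0 closes; this file moves no counter.
-/

set_option autoImplicit false
set_option linter.dupNamespace false -- the mandated namespace repeats `HodgeConjecture.HodgeConjecture`

noncomputable section

open scoped Matrix
open NumberField IsDedekindDomain

namespace Summit.HodgeConjecture.HodgeConjecture.Cruxes.HLiu418.K2LiuFirstTermLineLiftRankRowSmallLetters

/-! ## §1.1 `hπ`: a non-zero hermitian matrix pairs non-trivially with some hermitian matrix -/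
section Pairing

variable {R : Type*} [CommRing R] {F : Type*} [Field F] [Algebra F R] (σ : R →+* R) (τ : R →ₗ[F] F)

/-- **U2a's letter `hπ` for trace-type pairings.**  Let `σ` be an involution of `R`, `τ : R →ₗ[F] F` a `σ`-invariant functional whose form `(x, y) ↦ τ (y x)` is
non-degenerate, `2 ≠ 0` in `F`, and `π s H = τ (tr (s H))`.  Then every non-zero `σ`-hermitian `2 × 2` matrix `H` has a `σ`-hermitian partner `s` with `π s H ≠ 0`:
if `H₀₁ ≠ 0` take `s = [[0, σ d], [d, 0]]` (`π s H = 2 τ(d H₀₁)`), else `H` is diagonal with some `H_ii ≠ 0` and `s = (y + σ y) • E_ii` gives `π s H = 2 τ(y H_ii)`.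
[cite: Rallis1984, §4] [cite: KudlaRallis1994, §3] -/
theorem exists_herm_pairing_ne_zero (h2 : (2 : F) ≠ 0) (hσ : ∀ x, σ (σ x) = x) (hτσ : ∀ x, τ (σ x) = τ x)
    (hτ : ∀ x : R, x ≠ 0 → ∃ y : R, τ (y * x) ≠ 0)
    (π : Matrix (Fin 2) (Fin 2) R →ₗ[F] Matrix (Fin 2) (Fin 2) R →ₗ[F] F) (hπτ : ∀ s H, π s H = τ (s * H).trace)
    (H : Matrix (Fin 2) (Fin 2) R) (hH : (H.map σ)ᵀ = H) (hH0 : H ≠ 0) :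
    ∃ s : Matrix (Fin 2) (Fin 2) R, (s.map σ)ᵀ = s ∧ π s H ≠ 0 := by
  -- hermitian symmetry of the entries: `H j i = σ (H i j)`
  have hsym : ∀ i j, H j i = σ (H i j) := fun i j => by
    have h := congr_fun (congr_fun hH j) i
    rw [Matrix.transpose_apply, Matrix.map_apply] at h
    exact h.symm
  by_cases h01 : H 0 1 = 0
  · -- `H` is diagonal; some diagonal entry is non-zero
    have h10 : H 1 0 = 0 := by rw [hsym 0 1, h01, map_zero]
    have hdiag : ∃ i : Fin 2, H i i ≠ 0 := by
      by_contra hall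
      apply hH0
      ext i j
      fin_cases i <;> fin_cases j
      · exact not_not.1 fun h => hall ⟨0, h⟩
      · exact h01
      · exact h10
      · exact not_not.1 fun h => hall ⟨1, h⟩
    obtain ⟨i, hi⟩ := hdiag
    have hii : σ (H i i) = H i i := (hsym i i).symm
    obtain ⟨y, hy⟩ := hτ (H i i) hi
    refine ⟨Matrix.single i i (y + σ y), ?_, ?_⟩
    · ext j k
      simp only [Matrix.transpose_apply, Matrix.map_apply, Matrix.single_apply]
      by_cases hj : i = j
      · by_cases hk : i = k
        · rw [if_pos ⟨hk, hj⟩, if_pos ⟨hj, hk⟩, map_add, hσ, add_comm]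
        · rw [if_neg (fun h => hk h.1), if_neg (fun h => hk h.2), map_zero]
      · rw [if_neg (fun h => hj h.2), if_neg (fun h => hj h.1), map_zero]
    · have hsy : H i i * σ y = σ (H i i * y) := by rw [map_mul, hii]
      rw [hπτ, Matrix.trace_mul_comm, K2LiuSiegelUnipotentCharacters.trace_mul_single, mul_add, map_add, hsy, hτσ, ← two_mul,
        mul_comm (H i i) y]
      exact mul_ne_zero h2 hy
  · -- an off-diagonal entry is non-zero
    obtain ⟨y, hy⟩ := hτ (H 0 1) h01
    refine ⟨!![0, σ y; y, 0], ?_, ?_⟩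
    · ext i j
      fin_cases i <;> fin_cases j <;> simp [Matrix.transpose_apply, Matrix.map_apply, hσ]
    · have htr : (!![0, σ y; y, 0] * H).trace = σ (y * H 0 1) + y * H 0 1 := by
        rw [Matrix.trace_fin_two, Matrix.mul_apply, Matrix.mul_apply, Fin.sum_univ_two, Fin.sum_univ_two, hsym 0 1, map_mul]
        simp
      rw [hπτ, htr, map_add, hτσ, ← two_mul]
      exact mul_ne_zero h2 hy

end Pairing

/-! ## §1.2 `hκι`: the finite Siegel unipotents at one place `v`, as finite-adelic points of `U(diagonal dD)` -/
section Kappa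

open Literature.NumberTheory.Automorphic Literature.NumberTheory.GaloisRepresentations
open Literature.NumberTheory.GelbartRogawski1991 Literature.NumberTheory.GelbartRogawski1991.GRConstruction
open Literature.NumberTheory.K2Lit.SiegelDoubled Literature.NumberTheory.K2Lit.DoubledLineTheta
open K2LiuSiegelUnipotentFourierDefs (unipDeltaChar)
open K2LiuSiegelUnipotentLocalDefs (unipDeltaLoc locToAdelic_mem_unipDelta)
open K2LiuSiegelUnipotentCharacters (unipDeltaChar_mul unipDeltaChar_one)

/-- transport of the place inclusion along an equality of Gram matrices: for `J = J′` (and the induced equality of the local groups), the finite-adelic point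
`(1, …, z, …, 1)` of `U(J)` and of `U(J′)` have the same underlying adelic matrix. [cite: GelbartRogawski1991, §3.1 Prop. 3.1.1 p. 455] -/
theorem coe_finAdelicToAdelic_inclPlace_subgroupCongr (F E : Type) [Field F] [NumberField F] [Field E] [NumberField E] [Algebra F E]
    (c : E ≃ₐ[F] E) (N : ℕ) {J J' : Matrix (Fin N) (Fin N) E} (h : J = J') (v : HeightOneSpectrum (𝓞 F))
    (hJ : UnitaryGroup.localPi E c N J v = UnitaryGroup.localPi E c N J' v) (z : UnitaryGroup.localPi E c N J v) :
    UnitaryGroup.adelicVal F E c N J (UnitaryGroup.finAdelicToAdelic F E c N J (UnitaryGroup.inclPlace F E c N J v z)) =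
      UnitaryGroup.adelicVal F E c N J' (UnitaryGroup.finAdelicToAdelic F E c N J' (UnitaryGroup.inclPlace F E c N J' v (MulEquiv.subgroupCongr hJ z))) := by
  subst h
  rfl

variable (L : Type) [Field L] [NumberField L] [IsCMField L]
variable {N M n : ℕ} (e : Fin N × Fin M ≃ Fin n)
  (dV : Fin N → L) (hdV : ∀ i, IsCMField.complexConj L (dV i) = dV i)
  (dW : Fin M → L) (hdW : ∀ i, IsCMField.complexConj L (dW i) = dW i)
  (v : HeightOneSpectrum (𝓞 (Fp L)))

/-- the local groups of `J^𝔻 = hermD` and of `diagonal dD` at `v` coincide (★ `hermD_eq_diagonal_dD`). [cite: GelbartRogawski1991, §3.1 Prop. 3.1.1 p. 455] -/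
theorem localPi_hermD_eq_localPi_diagonal :
    UnitaryGroup.localPi L (IsCMField.complexConj L) (n + n) (hermD L e dV hdV dW hdW) v =
      UnitaryGroup.localPi L (IsCMField.complexConj L) (n + n) (Matrix.diagonal (dD L e dV hdV dW hdW)) v := by
  rw [hermD_eq_diagonal_dD]

/-- **★ p863159's `hκι` AT `Z := N_Δ(L⁺_v)`**: for every local element `z ∈ H(L⁺_v)`, the adelic element `toDiagA (ι_v z)` of `U(diagonal dD)(𝔸)` is the image of
the FINITE-adelic point `κ z := inclPlace v (z read in U(diagonal dD)(L⁺_v))` — all maps are identities on matrices (★ `coe_toDiagA`, ★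
`locToAdelic_eq_finAdelicToAdelic_inclPlace`, ★ `hermD_eq_diagonal_dD`). [cite: GelbartRogawski1991, §3.1 Prop. 3.1.1 p. 455] [cite: MoeglinWaldspurger1995, I.2.1] -/
theorem toDiagA_locToAdelic_eq_finAdelicToAdelic
    (z : UnitaryGroup.localPi L (IsCMField.complexConj L) (n + n) (hermD L e dV hdV dW hdW) v) :
    toDiagA L e dV hdV dW hdW (locToAdelic L e dV hdV dW hdW v z) =
      UnitaryGroup.finAdelicToAdelic (Fp L) L (IsCMField.complexConj L) (n + n) (Matrix.diagonal (dD L e dV hdV dW hdW))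
        (UnitaryGroup.inclPlace (Fp L) L (IsCMField.complexConj L) (n + n) (Matrix.diagonal (dD L e dV hdV dW hdW)) v
          (MulEquiv.subgroupCongr (localPi_hermD_eq_localPi_diagonal L e dV hdV dW hdW v) z)) := by
  apply Subtype.ext
  rw [coe_toDiagA]
  exact coe_finAdelicToAdelic_inclPlace_subgroupCongr (Fp L) L (IsCMField.complexConj L) (n + n) (hermD_eq_diagonal_dD L e dV hdV dW hdW) v
    (localPi_hermD_eq_localPi_diagonal L e dV hdV dW hdW v) z

/-- **`∃ κ` form of `hκι` on `Z := ↥(unipDeltaLoc … v)`** with `ι z := ⟨locToAdelic v z, _⟩`: the homomorphism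
`κ := inclPlace v ∘ (localPi hermD v ≃* localPi (diagonal dD) v) ∘ subtype`. [cite: GelbartRogawski1991, §3.1 Prop. 3.1.1 p. 455] [cite: MoeglinWaldspurger1995, I.2.1] -/
theorem exists_kappa_toDiagA_locToAdelic :
    ∃ κ : ↥(unipDeltaLoc L e dV hdV dW hdW v) →* UnitaryGroup.finAdelic (Fp L) L (IsCMField.complexConj L) (n + n) (Matrix.diagonal (dD L e dV hdV dW hdW)),
      ∀ z : ↥(unipDeltaLoc L e dV hdV dW hdW v),
        toDiagA L e dV hdV dW hdW (locToAdelic L e dV hdV dW hdW v (z : UnitaryGroup.localPi L (IsCMField.complexConj L) (n + n) (hermD L e dV hdV dW hdW) v)) =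
          UnitaryGroup.finAdelicToAdelic (Fp L) L (IsCMField.complexConj L) (n + n) (Matrix.diagonal (dD L e dV hdV dW hdW)) (κ z) :=
  ⟨(UnitaryGroup.inclPlace (Fp L) L (IsCMField.complexConj L) (n + n) (Matrix.diagonal (dD L e dV hdV dW hdW)) v).comp
      ((MulEquiv.subgroupCongr (localPi_hermD_eq_localPi_diagonal L e dV hdV dW hdW v)).toMonoidHom.comp (unipDeltaLoc L e dV hdV dW hdW v).subtype),
    fun z => toDiagA_locToAdelic_eq_finAdelicToAdelic L e dV hdV dW hdW v z⟩

/-! ## §1.3 `χ` with `hχS` by construction: the unipotent character `ψ_S ∘ ι_v` as a homomorphism `N_Δ(L⁺_v) →* ℂˣ` -/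

/-- **THE MULTIPLIER CHARACTER `χ := ψ_S ∘ ι_v : N_Δ(L⁺_v) →* ℂˣ`** — a homomorphism (★ `unipDeltaChar_mul ∕ _one` on `N_Δ(𝔸)`, `Circle.toUnits`) with
`(χ z : ℂ) = ψ_S(ι_v z)` for every `z`, i.e. ED. 2's letter `hχS` BY CONSTRUCTION at `ι z := ⟨locToAdelic v z, _⟩`.
[cite: Shimura1997, §18.1] [cite: MoeglinWaldspurger1995, I.2.6] -/
theorem exists_hom_coe_eq_unipDeltaChar_locToAdelic (S : Matrix (Fin n) (Fin n) L) :
    ∃ χ : ↥(unipDeltaLoc L e dV hdV dW hdW v) →* ℂˣ, ∀ z : ↥(unipDeltaLoc L e dV hdV dW hdW v),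
      ((χ z : ℂˣ) : ℂ) =
        (unipDeltaChar L e dV hdV dW hdW S
            (locToAdelic L e dV hdV dW hdW v (z : UnitaryGroup.localPi L (IsCMField.complexConj L) (n + n) (hermD L e dV hdV dW hdW) v)) : ℂ) := by
  refine ⟨Circle.toUnits.comp
    { toFun := fun z => unipDeltaChar L e dV hdV dW hdW S
        (locToAdelic L e dV hdV dW hdW v (z : UnitaryGroup.localPi L (IsCMField.complexConj L) (n + n) (hermD L e dV hdV dW hdW) v))
      map_one' := by rw [OneMemClass.coe_one, map_one, unipDeltaChar_one]
      map_mul' := fun z w => by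
        rw [Subgroup.coe_mul, map_mul, unipDeltaChar_mul L e dV hdV dW hdW S (locToAdelic_mem_unipDelta L e dV hdV dW hdW z.2)
          (locToAdelic_mem_unipDelta L e dV hdV dW hdW w.2)] }, fun z => ?_⟩
  rfl

end Kappa

end Summit.HodgeConjecture.HodgeConjecture.Cruxes.HLiu418.K2LiuFirstTermLineLiftRankRowSmallLetters

end
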